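import Literature.NumberTheory.Rogawski1990.ArchHCOrbitalFamiliesNondeg        -- ★ CUT B p851672: `exists_jc_archHCSpaceG_orbFamGExt_of_ne_zero` (+ ★ `ArchHCSpaceG`, ★ `orbFamGExt`, ★ `slotSign`, the atlas)
import Literature.NumberTheory.Rogawski1990.ArchTransfFamilyJumpKit             -- ★ `slotSign_of_mem_splitChartPlaces`
import Literature.NumberTheory.Rogawski1990.ArchTransfFamilyWallGeometry        -- ★ `contDiff_archERhoG`, `eq_or_eq_or_eq_hcThird`
import Literature.NumberTheory.Automorphic.Shelstad1979.OneSidedJumpLeibniz     -- ★ `tendsto_iteratedFDeriv_apply_ray`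
import Literature.NumberTheory.Automorphic.ArchCongruenceOrbitalTransport      -- ★ the quasi-split weights `β = (½, 1, −½)`: `re_embedding_quasiSplitWeights`, `quasiSplitWeights_ne_zero`
import Literature.NumberTheory.Rogawski1990.ArchInnerTwistChartDictionary     -- ★ p851905 (LH7-p04 (g8), brick (3)): `mem_splitChartPlaces_quasiSplitWeights`
import HarnessLib

/-!
# The FORWARD half of the archimedean inner transfer: the `G′`-orbital families on the quasi-split atlas

Topic `NumberTheory/Rogawski1990`; namespace `Literature.NumberTheory.Rogawski1990`.  THEOREMS ONLY (no `def`,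
no instance, no notation, no axiom, no named fact, no `sorry`).  Cell `pub/hodgecm-mathlib`, crux H413
(`stmt-HodgeConjecture-24833`), road «N8-INNER» (row 2 `stub_N8`, archimedean INNER transfer `G′_∞ → G_∞`,
LEAD T14-4 (L2); dealer LH2-plan (g1) DEAL #1), brick **(6) «FORWARD»** in the currency (D1) + (D2′) = «IMAGE»
(the STABLE family is `stableSumG` of the ORDINARY one; ref5 R-726).

THE MATHEMATICS.  `G′_∞ = U(σ(diag α))`, `α` a house frame of `L` (`α_i ≠ 0`, `σ_w α_i` real): at an
INDEFINITE place `U(2,1)`, at a DEFINITE place `U(3)`.  `G_∞ = U(σ(diag β))`, `β = (½, 1, −½)`: `U(2,1)` at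
EVERY place.  The Cartan atlas (★ `ArchInnerFormCartanAtlas*`) is indexed by the split-chart labels
`S′ ⊆ W` and the slot coordinates `c : W → Fin 3 → ℝ`; its slots are SIGN-ALIGNED by construction
(★ `lineOf`): at an indefinite place slots `0, 1` carry the common sign and slot `2` the odd one, at a definite
place all three signs agree (★ `slotSign`).  Hence the compact walls of the `β`-atlas (`(0,1)` at every place)
are compact walls of the `α`-atlas, and the only walls that are NONCOMPACT for `β` but COMPACT for `α` sit at the
DEFINITE places of `α` — where the `α`-family is smooth across every wall (compact group) and where the adjacent
split chart `insert w S′` is NOT an admissible `α`-label, so the wall-extended ordinary family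
★ `orbFamGExt L α ν′ a′` vanishes identically on it (★ `orbFamGExt_of_not_admissible`).  Consequently the
transported, zero-extended ordinary family of the census (§2 row «FORWARD∕IMAGE HALF») IS `orbFamGExt L α ν′ a′`
itself, read on the `β`-atlas, and

  `orbFamGExt L α ν′ a′ ∈ ArchHCSpaceG (slotSign L α) jc′ ⟹ orbFamGExt L α ν′ a′ ∈ ArchHCSpaceG (slotSign L β) jc″`

for every `jc″` agreeing with `jc′` at the indefinite places of `α` (at the definite ones `jc″` is FREE: the
required jump is `jc″ · 0 = 0` and the family is smooth there).  This is §1's generic SIGN-REFINEMENT lemma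
`archHCSpaceG_of_signRefinement` (any index type `W`, any `s ⊒ s′`, any family), instantiated in §3; with the
letter-L1 head of CUT B (★ `exists_jc_archHCSpaceG_orbFamGExt_of_ne_zero`) it gives the head
`archHCSpaceG_innerTransport`.  What is NOT here (other bricks of the road): the identification of `jc′` with
the CANONICAL jump constants of `G_∞` at the indefinite places ((5) J′-TRANSPORT — the `jc″` binder is that
slot), the `stableSumG` re-spelling and the READ identity ((2)∕(4)), the junction ((11)).

References: D. Shelstad, *Characters and inner forms of a quasi-split group over ℝ*, Compositio Math. 39
(1979), §4 pp. 22–26 (the space of the `'F_f`, properties (I)–(III), Prop. 4.5); A. Bouaziz, *Intégrales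
orbitales sur les groupes de Lie réductifs*, Ann. Sci. ÉNS 27 (1994), §3.1–3.2 pp. 579–581 (`I(U)`, (I₁)–(I₄));
J. Rogawski, *Automorphic Representations of Unitary Groups in Three Variables* (1990), §14.2 pp. 232–233
((14.2.1), «the existence of `f_v` follows from Shelstad»).
-/

set_option autoImplicit false

noncomputable section

open MeasureTheory MeasureTheory.Measure NumberField NumberField.InfinitePlace Matrix Complex Set Filter Topology
open scoped MatrixGroups Matrix ContDiff Classical
open Literature.NumberTheory.Automorphic Literature.NumberTheory.Automorphic.UnitaryGroup Literature.NumberTheory.Automorphic.ArchCartan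
open Literature.NumberTheory.Automorphic.Shelstad1979.StableOrbitalIntegrals
open Literature.NumberTheory.GaloisRepresentations

namespace Literature.NumberTheory.Rogawski1990

/-! ## §1 Sign refinement on `ArchHCSpaceG` (generic index type) -/

section SignRefinement

variable {W : Type*} [Fintype W] [DecidableEq W]

omit [Fintype W] [DecidableEq W] in
/-- **`InRegG` is antitone in the compact-pair relation**: if every `s′`-compact pair is `s`-compact, then
`T_{in-reg}` for `s′` (fewer walls kept) lies inside `T_{in-reg}` for `s`.
[cite: Bouaziz1994IntegralesOrbitales, §3.1 p. 579 (T_{in-reg})] -/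
theorem inRegG_subset_inRegG_of_signRefinement {s s' : W → Fin 3 → SignType}
    (hcomp : ∀ (w : W) (i j : Fin 3), s' w i = s' w j → s w i = s w j) (S' : Finset W) :
    InRegG s' S' ⊆ InRegG s S' := by
  intro c hc w hw i j hij hs
  exact hc w hw i j hij fun h => hs (hcomp w i j h)

omit [Fintype W] in
/-- **A semiregular point of an `s`-COMPACT wall is an in-regular point for `s`**: on the wall `(w, i, j)` with
`s w i = s w j`, the third eigenvalue at `w` distinct and every other place regular, no NONCOMPACT wall of `s`
passes through the point. [cite: Shelstad1979, §4 p. 22] [cite: Bouaziz1994IntegralesOrbitales, §3.2 p. 580] -/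
theorem HcSemireg.mem_inRegG_of_eq {s : W → Fin 3 → SignType} {S' : Finset W} {w : W} {i j : Fin 3}
    {p : W → Fin 3 → ℝ} (hp : HcSemireg S' w i j p) (hij : i ≠ j) (hs : s w i = s w j) :
    p ∈ InRegG s S' := by
  obtain ⟨hwall, hthird, hreg, -⟩ := hp
  intro w' hw' k l hkl hskl hexp
  by_cases hw'w : w' = w
  · subst hw'w
    rcases eq_or_eq_or_eq_hcThird hij k with rfl | rfl | rfl <;>
      rcases eq_or_eq_or_eq_hcThird hij l with rfl | rfl | rfl
    · exact hkl rfl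
    · exact hskl hs
    · exact hthird hexp.symm
    · exact hskl hs.symm
    · exact hkl rfl
    · exact hthird (by rw [hwall]; exact hexp.symm)
    · exact hthird hexp
    · exact hthird (by rw [hwall]; exact hexp)
    · exact hkl rfl
  · exact hkl (hreg w' hw' hw'w hexp)

/-- **The `ρ`-twisted jets of a member are CONTINUOUS along every ray through an in-regular point** (the
product `eρ_{S′} · F_{S′}` is `C^∞` on the open `T_{in-reg}`). [cite: Bouaziz1994IntegralesOrbitales, §3.1 (I₂) p. 579]
[cite: Shelstad1979, §4 (II) p. 23] -/
theorem tendsto_hcTwistedDeriv_add_smul_of_mem_inRegG {s : W → Fin 3 → SignType}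
    {F : Finset W → (W → Fin 3 → ℝ) → ℂ} (hS : ArchHcSmoothOneSided s F) (S' : Finset W)
    {p : W → Fin 3 → ℝ} (hp : p ∈ InRegG s S') (v : W → Fin 3 → ℝ) (n : ℕ)
    (dirs : Fin n → (W → Fin 3 → ℝ)) :
    Tendsto (fun ν : ℝ => hcTwistedDeriv S' n dirs (F S') (p + ν • v)) (𝓝 0)
      (𝓝 (hcTwistedDeriv S' n dirs (F S') p)) := by
  have hu : ContDiffOn ℝ ∞ (fun c => archERhoG S' c * F S' c) (InRegG s S') :=
    (contDiff_archERhoG S').contDiffOn.mul (hS S').1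
  exact tendsto_iteratedFDeriv_apply_ray (isOpen_inRegG s S') hp hu v n dirs

/-- **SIGN REFINEMENT ON HARISH-CHANDRA'S SPACE.**  Let `s, s′` be two sign patterns on the same atlas such
that every `s′`-compact pair is `s`-compact (`hcomp`), let the constants `jc″` agree with `jc′` on the
`s`-noncompact walls (`hjc`), and let the family `F` vanish on the Cayley chart `insert w S′` of every wall
`(w, i, j)` that is noncompact for `s′` but compact for `s` (`hzero`).  Then
`F ∈ ArchHCSpaceG s jc′ ⟹ F ∈ ArchHCSpaceG s′ jc″`: (P), (I₄) are untouched, (W) for `s′` is a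
sub-conjunction, `T_{in-reg}(s′) ⊆ T_{in-reg}(s)` gives (I₁)+(I₂), and at a NEW jump wall the semiregular
point is in-regular for `s`, so the twisted jets are continuous along the normal and the required jump is
`jc″ · I^k · Dⁿ(eρ · 0)(Cayley point) = 0` — Shelstad's (II)∕(III) for a wall that is compact on one side of
an inner twist and faces no split Cartan on the other. [cite: Shelstad1979, §4 (II)–(III) pp. 23–26, Prop. 4.5 (p. 26)]
[cite: Bouaziz1994IntegralesOrbitales, §3.1–3.2 pp. 579–580] -/
theorem archHCSpaceG_of_signRefinement {s s' : W → Fin 3 → SignType}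
    {jc' jc'' : Finset W → W → Fin 3 → Fin 3 → ℂ} {F : Finset W → (W → Fin 3 → ℝ) → ℂ}
    (hcomp : ∀ (w : W) (i j : Fin 3), s' w i = s' w j → s w i = s w j)
    (hjc : ∀ (S' : Finset W) (w : W) (i j : Fin 3), w ∉ S' → i ≠ j → s w i ≠ s w j →
      jc'' S' w i j = jc' S' w i j)
    (hzero : ∀ (S' : Finset W) (w : W) (i j : Fin 3), w ∉ S' → i ≠ j → s' w i ≠ s' w j → s w i = s w j →
      F (insert w S') = fun _ => 0)
    (hF : ArchHCSpaceG s jc' F) : ArchHCSpaceG s' jc'' F := by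
  obtain ⟨hP, hW, hS, hC, hJ⟩ := hF
  refine ⟨hP, ⟨fun S' c w i j hw hij hs' => hW.1 S' c w i j hw hij (hcomp w i j hs'), hW.2⟩,
    fun S' => ⟨?_, ?_, ?_⟩, hC, ?_⟩
  · exact (hS S').1.mono (inRegG_subset_inRegG_of_signRefinement hcomp S')
  · intro n K hK
    exact ((hS S').2.1 n K hK).mono
      (image_mono (inter_subset_inter_right _ (inRegG_subset_inRegG_of_signRefinement hcomp S')))
  · intro w hw i j hij hs' p hp n m
    by_cases hs : s w i = s w j
    · have hpin : p ∈ InRegG s S' := hp.mem_inRegG_of_eq hij hs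
      exact ⟨_, _, (tendsto_hcTwistedDeriv_add_smul_of_mem_inRegG hS S' hpin _ n _).mono_left nhdsWithin_le_nhds,
        (tendsto_hcTwistedDeriv_add_smul_of_mem_inRegG hS S' hpin _ n _).mono_left nhdsWithin_le_nhds⟩
    · exact (hS S').2.2 w hw i j hij hs p hp n m
  · intro S' w hw i j hij hs' p hp n m
    by_cases hs : s w i = s w j
    · have hpin : p ∈ InRegG s S' := hp.mem_inRegG_of_eq hij hs
      have h0 : F (insert w S') = fun _ => 0 := hzero S' w i j hw hij hs' hs
      refine ⟨_, _, (tendsto_hcTwistedDeriv_add_smul_of_mem_inRegG hS S' hpin _ n _).mono_left nhdsWithin_le_nhds,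
        (tendsto_hcTwistedDeriv_add_smul_of_mem_inRegG hS S' hpin _ n _).mono_left nhdsWithin_le_nhds, ?_⟩
      rw [sub_self, h0, hcTwistedDeriv_fun_zero, mul_zero]
    · rw [hjc S' w i j hw hij hs]
      exact hJ S' w hw i j hij hs p hp n m

/-- **Same constants.**  The special case `jc″ = jc′`. [cite: Shelstad1979, §4 (II)–(III) pp. 23–26] -/
theorem archHCSpaceG_of_signRefinement_same {s s' : W → Fin 3 → SignType}
    {jc' : Finset W → W → Fin 3 → Fin 3 → ℂ} {F : Finset W → (W → Fin 3 → ℝ) → ℂ}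
    (hcomp : ∀ (w : W) (i j : Fin 3), s' w i = s' w j → s w i = s w j)
    (hzero : ∀ (S' : Finset W) (w : W) (i j : Fin 3), w ∉ S' → i ≠ j → s' w i ≠ s' w j → s w i = s w j →
      F (insert w S') = fun _ => 0)
    (hF : ArchHCSpaceG s jc' F) : ArchHCSpaceG s' jc' F :=
  archHCSpaceG_of_signRefinement hcomp (fun _ _ _ _ _ _ _ => rfl) hzero hF

end SignRefinement

/-! ## §2 Slot-sign bookkeeping: the house frame `α` and the quasi-split weights `β = (½, 1, −½)` -/

section SlotSigns

variable (L : Type) [Field L] [NumberField L] [IsCMField L] (α : Fin 3 → L)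

omit [NumberField L] [IsCMField L] in
/-- **At a split-chart (indefinite) place two slots have the same sign iff neither or both are the odd slot `2`.**
[cite: Rogawski1990, §3.6 p. 31; §14.2 p. 232] -/
theorem slotSign_eq_slotSign_iff_of_mem_splitChartPlaces (hα : ∀ i, α i ≠ 0)
    {w : {w : InfinitePlace L // IsComplex w}} (hw : w ∈ splitChartPlaces L α) (i j : Fin 3) :
    slotSign L α w i = slotSign L α w j ↔ (i = 2 ↔ j = 2) := by
  obtain ⟨h10, h20, hne⟩ := slotSign_of_mem_splitChartPlaces L α hα hw
  have hneg : -slotSign L α w 0 ≠ slotSign L α w 0 := by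
    revert hne; generalize slotSign L α w 0 = t; revert t; decide
  fin_cases i <;> fin_cases j <;>
    simp [h10, h20, hneg, hneg.symm]

omit [NumberField L] [IsCMField L] in
/-- **At a place that is NOT a split-chart place (a definite place of the real house frame) all three slots carry
the same sign.** [cite: Rogawski1990, §3.6 p. 31; §14.2 p. 232] -/
theorem slotSign_eq_slotSign_of_not_mem_splitChartPlaces (hα : ∀ i, α i ≠ 0)
    {w : {w : InfinitePlace L // IsComplex w}} (hreal : ∀ k, (w.1.embedding (α k)).im = 0)
    (hw : w ∉ splitChartPlaces L α) (i j : Fin 3) : slotSign L α w i = slotSign L α w j := by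
  -- not a split-chart place of a real frame ⇒ the form signs all agree
  have hdef : formSign L α w 0 = formSign L α w 1 ∧ formSign L α w 1 = formSign L α w 2 := by
    by_contra hind
    exact hw (mem_splitChartPlaces_of_frame hα hreal hind)
  have hall : ∀ k, formSign L α w k = formSign L α w 0 := by
    intro k
    fin_cases k
    · rfl
    · exact hdef.1.symm
    · exact hdef.2.symm.trans hdef.1.symm
  rw [slotSign_apply, slotSign_apply, hall (lineOf (formSign L α w) i), hall (lineOf (formSign L α w) j)]

omit [IsCMField L] in
/-- **Slot signs of `β`: same sign iff neither or both slots are the odd slot `2`**, at every place.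
[cite: Rogawski1990, §14.1 p. 232; §3.6 p. 31] -/
theorem slotSign_quasiSplitWeights_eq_iff (w : {w : InfinitePlace L // IsComplex w}) (i j : Fin 3) :
    slotSign L ![(2 : L)⁻¹, 1, -(2 : L)⁻¹] w i = slotSign L ![(2 : L)⁻¹, 1, -(2 : L)⁻¹] w j ↔ (i = 2 ↔ j = 2) :=
  slotSign_eq_slotSign_iff_of_mem_splitChartPlaces L _ (quasiSplitWeights_ne_zero L)
    (mem_splitChartPlaces_quasiSplitWeights L w) i j

omit [NumberField L] [IsCMField L] in
/-- **Compact pairs of `β` are compact pairs of `α`** (the hypothesis `hcomp` of §1 for the inner twist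
`U(diag α) ⟶ U(diag β)`): at an indefinite place of `α` the two patterns have the same walls, at a definite place
of `α` every pair is compact. [cite: Rogawski1990, §14.2 p. 232; §3.6 p. 31] -/
theorem slotSign_eq_of_slotSign_quasiSplitWeights_eq [NumberField L] (hα : ∀ i, α i ≠ 0)
    (hreal : ∀ (w : {w : InfinitePlace L // IsComplex w}) (k : Fin 3), (w.1.embedding (α k)).im = 0)
    (w : {w : InfinitePlace L // IsComplex w}) (i j : Fin 3)
    (h : slotSign L ![(2 : L)⁻¹, 1, -(2 : L)⁻¹] w i = slotSign L ![(2 : L)⁻¹, 1, -(2 : L)⁻¹] w j) :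
    slotSign L α w i = slotSign L α w j := by
  by_cases hw : w ∈ splitChartPlaces L α
  · exact (slotSign_eq_slotSign_iff_of_mem_splitChartPlaces L α hα hw i j).2
      ((slotSign_quasiSplitWeights_eq_iff L w i j).1 h)
  · exact slotSign_eq_slotSign_of_not_mem_splitChartPlaces L α hα (hreal w) hw i j

omit [NumberField L] [IsCMField L] in
/-- **A wall that is noncompact for `β` but compact for `α` sits at a definite place of `α`** (not a split-chart
place). [cite: Rogawski1990, §14.2 p. 232; §3.6 p. 31] -/
theorem not_mem_splitChartPlaces_of_slotSign_eq_of_quasiSplitWeights_ne [NumberField L] (hα : ∀ i, α i ≠ 0)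
    {w : {w : InfinitePlace L // IsComplex w}} {i j : Fin 3}
    (hne : slotSign L ![(2 : L)⁻¹, 1, -(2 : L)⁻¹] w i ≠ slotSign L ![(2 : L)⁻¹, 1, -(2 : L)⁻¹] w j)
    (heq : slotSign L α w i = slotSign L α w j) : w ∉ splitChartPlaces L α := by
  intro hw
  exact hne ((slotSign_quasiSplitWeights_eq_iff L w i j).2
    ((slotSign_eq_slotSign_iff_of_mem_splitChartPlaces L α hα hw i j).1 heq))

end SlotSigns

/-! ## §3 The head: the `G′`-orbital families lie in Harish-Chandra's space of the quasi-split atlas -/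

section Head

variable (L : Type) [Field L] [NumberField L] [IsCMField L] (α : Fin 3 → L)
  [MeasurableSpace ↥(arch (↥(maximalRealSubfield L)) L (IsCMField.complexConj L) 3 (Matrix.diagonal α))]
  [BorelSpace ↥(arch (↥(maximalRealSubfield L)) L (IsCMField.complexConj L) 3 (Matrix.diagonal α))]
  (ν' : Measure ↥(arch (↥(maximalRealSubfield L)) L (IsCMField.complexConj L) 3 (Matrix.diagonal α)))
  [ν'.IsHaarMeasure] [ν'.IsMulRightInvariant]

/-- **FORWARD, membership form with the J′-slot.**  If the wall-extended ordinary orbital family of `a′` on the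
`G′`-atlas lies in `ArchHCSpaceG (slotSign L α) jc′` (letter L1), then — read on the quasi-split atlas of
`G_∞ = U(diag(½,1,−½))` — it lies in `ArchHCSpaceG (slotSign L β) jc″` for EVERY `jc″` that agrees with `jc′`
at the split-chart (indefinite) places of `α`; at the definite places of `α` the value of `jc″` is free (the
family is smooth across those walls and its Cayley chart is the zero label).  This is the transported,
zero-extended ordinary family of the FORWARD half of the inner transfer. [cite: Shelstad1979, §4 (II)–(III) pp. 23–26, Prop. 4.5 (p. 26)]
[cite: Rogawski1990, §14.2 (14.2.1) pp. 232–233] [cite: Bouaziz1994IntegralesOrbitales, §3.1–3.2 pp. 579–580] -/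
theorem archHCSpaceG_innerTransport_of_archHCSpaceG (hα : ∀ i, α i ≠ 0)
    (hreal : ∀ (w : {w : InfinitePlace L // IsComplex w}) (k : Fin 3), (w.1.embedding (α k)).im = 0)
    {jc' jc'' : Finset {w : InfinitePlace L // IsComplex w} → {w : InfinitePlace L // IsComplex w} → Fin 3 → Fin 3 → ℂ}
    (hjc : ∀ (S' : Finset {w : InfinitePlace L // IsComplex w}) (w : {w : InfinitePlace L // IsComplex w}) (i j : Fin 3),
      w ∉ S' → w ∈ splitChartPlaces L α → jc'' S' w i j = jc' S' w i j)
    {a' : ↥(arch (↥(maximalRealSubfield L)) L (IsCMField.complexConj L) 3 (Matrix.diagonal α)) → ℂ}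
    (ha' : ArchHCSpaceG (slotSign L α) jc' (orbFamGExt L α ν' a')) :
    ArchHCSpaceG (slotSign L ![(2 : L)⁻¹, 1, -(2 : L)⁻¹]) jc'' (orbFamGExt L α ν' a') := by
  refine archHCSpaceG_of_signRefinement (slotSign_eq_of_slotSign_quasiSplitWeights_eq L α hα hreal)
    (fun S' w i j hw _ hs => hjc S' w i j hw ?_) (fun S' w i j _ _ hs' hs => ?_) ha'
  · -- an `α`-noncompact pair exists only at a split-chart place
    by_contra hw'
    exact hs (slotSign_eq_slotSign_of_not_mem_splitChartPlaces L α hα (hreal w) hw' i j)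
  · -- a NEW jump wall sits at a definite place of `α`: the Cayley label is not admissible
    have hw' : w ∉ splitChartPlaces L α :=
      not_mem_splitChartPlaces_of_slotSign_eq_of_quasiSplitWeights_ne L α hα hs' hs
    exact orbFamGExt_of_not_admissible L α ν' a' (insert w S') fun h => hw' (h w (Finset.mem_insert_self w S'))

/-- **FORWARD, same constants.** [cite: Shelstad1979, §4 (II)–(III) pp. 23–26] [cite: Rogawski1990, §14.2 (14.2.1) pp. 232–233] -/
theorem archHCSpaceG_innerTransport_of_archHCSpaceG_same (hα : ∀ i, α i ≠ 0)
    (hreal : ∀ (w : {w : InfinitePlace L // IsComplex w}) (k : Fin 3), (w.1.embedding (α k)).im = 0)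
    {jc' : Finset {w : InfinitePlace L // IsComplex w} → {w : InfinitePlace L // IsComplex w} → Fin 3 → Fin 3 → ℂ}
    {a' : ↥(arch (↥(maximalRealSubfield L)) L (IsCMField.complexConj L) 3 (Matrix.diagonal α)) → ℂ}
    (ha' : ArchHCSpaceG (slotSign L α) jc' (orbFamGExt L α ν' a')) :
    ArchHCSpaceG (slotSign L ![(2 : L)⁻¹, 1, -(2 : L)⁻¹]) jc' (orbFamGExt L α ν' a') :=
  archHCSpaceG_innerTransport_of_archHCSpaceG L α ν' hα hreal (fun _ _ _ _ _ _ => rfl) ha'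

/-- **FORWARD (the head of brick (6) of the road «N8-INNER»).**  For a hermitian house frame `diag α` of the
CM field `L` (`α_i ≠ 0`) there are jump constants `jc′` such that for EVERY `a′ ∈ C_c^∞(G′_∞)`
(`ArchSmooth L 3 (diag α) a′`) the wall-extended ordinary orbital family `orbFamGExt L α ν′ a′` — which is
already `0` on every chart label meeting a definite place of `α` — lies in Harish-Chandra's space
`ArchHCSpaceG (slotSign L β) jc′` of the quasi-split atlas, `β = (½, 1, −½)`.  Letter L1 (★ CUT B
`exists_jc_archHCSpaceG_orbFamGExt_of_ne_zero`) + §1. [cite: Shelstad1979, §4 (II)–(III) pp. 23–26, Thm. 4.7 (p. 31)]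
[cite: Rogawski1990, §14.2 (14.2.1) pp. 232–233] [cite: Bouaziz1994IntegralesOrbitales, §3.2 p. 580; Thm. 3.2.1 p. 581] -/
theorem archHCSpaceG_innerTransport
    (hherm : ((Matrix.diagonal α).map (cmConjRingHom L)).transpose = Matrix.diagonal α) (hα : ∀ i, α i ≠ 0) :
    ∃ jc' : Finset {w : InfinitePlace L // IsComplex w} → {w : InfinitePlace L // IsComplex w} → Fin 3 → Fin 3 → ℂ,
      ∀ a' : ↥(arch (↥(maximalRealSubfield L)) L (IsCMField.complexConj L) 3 (Matrix.diagonal α)) → ℂ,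
        ArchSmooth L 3 (Matrix.diagonal α) a' →
          ArchHCSpaceG (slotSign L ![(2 : L)⁻¹, 1, -(2 : L)⁻¹]) jc' (orbFamGExt L α ν' a') := by
  obtain ⟨jc', hjc'⟩ := exists_jc_archHCSpaceG_orbFamGExt_of_ne_zero L α ν' hherm hα
  have hreal : ∀ (w : {w : InfinitePlace L // IsComplex w}) (k : Fin 3), (w.1.embedding (α k)).im = 0 :=
    fun w k => im_embedding_diagonal_eq_zero L 3 α (complexConj_apply_eq_of_diagonal_frame hherm) w k
  exact ⟨jc', fun a' ha' => archHCSpaceG_innerTransport_of_archHCSpaceG_same L α ν' hα hreal (hjc' a' ha')⟩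

/-- **FORWARD with the J′-slot.**  Same, for every `jc″` agreeing with the L1 constants at the split-chart
places of `α` (the binder that (5) J′-TRANSPORT and the junction (11) fill with the canonical constants of
`G_∞`). [cite: Shelstad1979, §4 Prop. 4.5 (p. 26)] [cite: Rogawski1990, §14.2 (14.2.1) pp. 232–233] -/
theorem archHCSpaceG_innerTransport_slot
    (hherm : ((Matrix.diagonal α).map (cmConjRingHom L)).transpose = Matrix.diagonal α) (hα : ∀ i, α i ≠ 0) :
    ∃ jc' : Finset {w : InfinitePlace L // IsComplex w} → {w : InfinitePlace L // IsComplex w} → Fin 3 → Fin 3 → ℂ,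
      ∀ a' : ↥(arch (↥(maximalRealSubfield L)) L (IsCMField.complexConj L) 3 (Matrix.diagonal α)) → ℂ,
        ArchSmooth L 3 (Matrix.diagonal α) a' →
          ∀ jc'' : Finset {w : InfinitePlace L // IsComplex w} → {w : InfinitePlace L // IsComplex w} → Fin 3 → Fin 3 → ℂ,
            (∀ (S' : Finset {w : InfinitePlace L // IsComplex w}) (w : {w : InfinitePlace L // IsComplex w}) (i j : Fin 3),
                w ∉ S' → w ∈ splitChartPlaces L α → jc'' S' w i j = jc' S' w i j) →
              ArchHCSpaceG (slotSign L ![(2 : L)⁻¹, 1, -(2 : L)⁻¹]) jc'' (orbFamGExt L α ν' a') := by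
  obtain ⟨jc', hjc'⟩ := exists_jc_archHCSpaceG_orbFamGExt_of_ne_zero L α ν' hherm hα
  have hreal : ∀ (w : {w : InfinitePlace L // IsComplex w}) (k : Fin 3), (w.1.embedding (α k)).im = 0 :=
    fun w k => im_embedding_diagonal_eq_zero L 3 α (complexConj_apply_eq_of_diagonal_frame hherm) w k
  exact ⟨jc', fun a' ha' jc'' hjc => archHCSpaceG_innerTransport_of_archHCSpaceG L α ν' hα hreal hjc (hjc' a' ha')⟩

end Head

end Literature.NumberTheory.Rogawski1990

end
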